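/-
Copyright (c) 2026 the pub-hodgecm-mathlib formalisation cell (harness21).  Prover seat hodgecm-mathlib-LH4-p11 (g7), req620 Track A «(D-RAM) FOUR-FRAME» squad, helper lane
on h413 = stmt-HodgeConjecture-24833 (count-neutral).  Dealer LH4-plan (g12) WORD #50 «(J-T+-derived)»: THE T₊ SOCKET OF THE DERIVED ROAD (LEAD T19-31 (b), F0P3-p01 (g35)
10:05Z shopping list): rows(f_{T+}) from the two clean-level rows, the sign-piece row and (α), by ★ p858649 linearity.  2026-09-04.
-/
import Summits.HodgeConjecture.HodgeConjecture.Theorems.F0P3cDyRamPieceRowsWildLinear          -- ★ p858649 (F0P3a-p01 (g35)): `pieceRowsWild_add_smul ∕ _sub ∕ _congr ∕ _iff_const`; brings ★ ProfilePiecesProps (`isLocSmooth_indicator_profile`, `isLocSmooth_pieceTransvPlus`, `uniformizer_facts`), ★ ProfileLevelClass (`inLevel_of_le`, `nearTransvShell_add_iff`, `labelPlus_add_iff`)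
import Summits.HodgeConjecture.HodgeConjecture.Theorems.F0P3cDyRamLevelsPieceCountDictionary   -- ★ p858704 (LH4-p06 (g6)): `isLocSmooth_indicator_levels` (the clean-level pieces are `C_c^∞`)
import HarnessLib

/-!
# Crux `H413`, line LH4 «(D-RAM) FOUR-FRAME» — THE T₊ SOCKET OF THE DERIVED ROAD: `PieceRowsWild gselStar 1` (the tier-0 row `stub_rows_transvPlus`'s TYPE) FROM
# rows(`𝟙_{K_{ℓ₀,m_c}}`) ∧ rows(`𝟙_{K_{ℓ₀+1,m_c}}`) ∧ rows(`f_sgn′`) ∧ (α), by the indicator identity `f_{T+} = ½·(𝟙_{lev(ℓ₀,m_c)} − 𝟙_{lev(ℓ₀+1,m_c)}) + ½·f_sgn′` and ★ p858649 linearity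

Cell `hodgecm-mathlib` (D-0151), FLOOR 0, crux item H413 = `stmt-HodgeConjecture-24833`, route of record `HCCMUnconditional`; squad F0∕P3c∕LH4 (req618∕req620); dealer
LH4-plan (g12) WORD #50 «(J-T+-derived)» (board §3); helper lane `--supports stmt-HodgeConjecture-24833 --as helper` (count-neutral).  THEOREMS ONLY (no `def`, no instance, no
notation, no `sorry`, default heartbeats).  A SOCKET IS LAW-FREE PLUMBING: nothing here states a census law or the label criterion (α) — they are HYPOTHESES; it pays no row.

THE DERIVED ROAD (LEAD T19-31 (b); F0P3-p01 (g35) 10:05:32Z∕10:05:48Z; LH4-p05 (g8) (L-T+)-SIG scratch v6 §3″ = the same identity at the COUNT level — his `cleanMinusFixCount`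
is the fixed-vertex census of the piece written `T−′` below; this file is the ROWS level, all three populations at once).  At a wild place write `X := ι_w u − 1`, `ℓ₀ := dOfPlace % 2`,
`m* := mstarFn`, and let `m_c ≥ m*` be a CLEAN square level (schedule `mc`; of record `2⌊(m* + d)∕2⌋`, LH4-p05's `mcOfRecord` — a parameter here).  Pieces on `K`:
`lev(a, m_c) := 𝟙{X ∈ ϖ^a M₃ ∧ X² ∈ ϖ^{m_c} M₃}` (★ p858704's `𝟙_{K_{a,b}}`), `f_{T+} := pieceTransvPlus = 𝟙{shell(ℓ₀, m*) ∧ LabelPlus(m*)}`, `T−′ := 𝟙{shell(ℓ₀, m_c) ∧ ¬LabelPlus(m*)}`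
(the CLEAN non-plus class — NOT Lean's `pieceTransvMinus`), `f_sgn′ := f_{T+} − T−′`.  (α) «LabelPlus IS CLEAN»: on `K`, `shell(ℓ₀, m*) X → LabelPlus X → X² ∈ ϖ^{m_c} M₃`
(the K-wide set identity of F0P3-p01's (α), in the direction the road consumes; LH4-p13 (g8) (L-lab-6∕-8) proves it).  THEN pointwise on `G_v`:
`f_{T+} = ½·(lev(ℓ₀, m_c) − lev(ℓ₀+1, m_c)) + ½·f_sgn′` (§0: `lev(ℓ₀,m_c) ∖ lev(ℓ₀+1,m_c)` = the clean shell = `f_{T+} ⊔ T−′` under (α) and `m* ≤ m_c`), so by ★ p858649 (`pieceRowsWild_sub`,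
`pieceRowsWild_add_smul`, `pieceRowsWild_congr`) the three population rows of `f_{T+}` follow from those of the two clean-level pieces and of `f_sgn′` — and rows(`f_sgn′`) is the
statement «the `Δ‴`-weighted class sums of `f_sgn′` are realised near `1` by an `H`-family», in particular by the EMPTY family when they VANISH ((β) of the shopping list).
The clean-level rows are exactly the conclusions of ★ p858924 `pieceRowsWild_levels_of_frameSignedCensus` at `(la, lb) := (ℓ₀, m_c), (ℓ₀+1, m_c)` (tie probe in HOME).

WHAT IS PROVED.
* §0 `indicator_eq_half_sub_add_half_of_split` — the four-proposition bookkeeping `𝟙_P = ½(𝟙_{Lo} − 𝟙_{Hi}) + ½(𝟙_P − 𝟙_M)` from `Hi → Lo`, `P, M ⊆ Lo ∖ Hi`, `Lo ∖ Hi ⊆ P ∪ M`, `P ∩ M = ∅`.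
* §1 **`pieceRowsWild_transvPlus_of_indicator_identity`** — ABSTRACT form: any smooth pieces `glo ghi fsgn` with `pieceTransvPlus = ½·(glo − ghi) + ½·fsgn` at every wild place
  and rows for each ⟹ `PieceRowsWild gselStar 1`.
* §2 `isLocSmooth_indicator_cleanMinus` — `T−′` is `C_c^∞` (★ `isLocSmooth_indicator_profile` at level `m_c + m* + 2`); **`pieceRowsWild_transvPlus_of_levels_of_sgn`** — THE SOCKET:
  `(mc) (hmc : m* ≤ m_c placewise) (hα) (hlo) (hhi) (hsgn) : PieceRowsWild gselStar 1`, the three row hypotheses being `PieceRowsWild ‹lev(ℓ₀,m_c)› 0`, `PieceRowsWild ‹lev(ℓ₀+1,m_c)› 0`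
  (★ p858924's conclusions) and `PieceRowsWild ‹f_{T+} − T−′› 0`.
HONEST LABEL.  Count-neutral (`--supports`): pays no registered stub, touches no `Lines/` module, states no census law and does NOT assert (α); `stub_rows_transvPlus` stays OPEN until
(α) (LH4-p13), the clean-level laws∕H-sides ((L-lev)∕(H-lev) at `m_c`) and the sign-piece rows ((β)) exist; `HC_CM` is proved only modulo the 7 printed citations (2 remaining
named inputs: hLiu418 = `stmt-HodgeConjecture-24832`, h413 = `stmt-HodgeConjecture-24833`) until rung 0 closes.

## References
* [Rogawski1990] J. D. Rogawski, *Automorphic Representations of Unitary Groups in Three Variables*, Ann. of Math. Stud. 123 (1990): §4.3 (4.3.1) p. 43; §4.9 Prop. 4.9.1 (a)(b) pp. 54–55, Lemma 4.9.3 p. 56.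
* [LanglandsShelstad1987] R. P. Langlands, D. Shelstad, *On the definition of transfer factors*, Math. Ann. 278 (1987), §1.3.
* [Kottwitz1986BaseChangeUnits] R. E. Kottwitz, *Base change for unit elements of Hecke algebras*, Compositio Math. 60 (1986), §1 pp. 240–241.
* [BernsteinZelevinsky1976] I. N. Bernstein, A. V. Zelevinsky, *Representations of the group GL(n, F) where F is a non-archimedean local field*, Russian Math. Surveys 31 (1976), §1.1.
-/

set_option autoImplicit false

noncomputable section

namespace Summit.HodgeConjecture.HodgeConjecture.Cruxes.H413.F0P3cDyRamTransvPlusRowsOfLevelsOfSgn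

open MeasureTheory Measure NumberField IsDedekindDomain Topology Filter
open Literature.NumberTheory.Automorphic Literature.NumberTheory.Automorphic.UnitaryGroup Literature.NumberTheory.Automorphic.IntegralReduction
open Literature.NumberTheory.Rogawski1990 Literature.NumberTheory.GaloisRepresentations
open Literature.NumberTheory.Automorphic.UnitaryThreeFourFrame
open Literature.MeasureTheory.Group (descConj)
open scoped Matrix MatrixGroups Classical ValuativeRel WithZero
open Summit.HodgeConjecture.HodgeConjecture.Cruxes.H413.F0P3cDyRamFourFramePieces
open Summit.HodgeConjecture.HodgeConjecture.Cruxes.H413.F0P3cDyRamProfilePiecesProps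
open Summit.HodgeConjecture.HodgeConjecture.Cruxes.H413.F0P3cDyRamProfileLevelClass
open Summit.HodgeConjecture.HodgeConjecture.Cruxes.H413.F0P3cDyRamPieceRowsWildLinear
open Summit.HodgeConjecture.HodgeConjecture.Cruxes.H413.F0P3cDyRamLevelsPieceCountDictionary

/-! ## §0  Indicator bookkeeping: `𝟙_P = ½(𝟙_{Lo} − 𝟙_{Hi}) + ½(𝟙_P − 𝟙_M)` when `Lo ∖ Hi = P ⊔ M` -/

/-- Four-proposition bookkeeping behind `f_{T+} = ½·(lev − lev′) + ½·f_sgn′`: if `Hi → Lo`, `P → Lo ∧ ¬Hi`, `M → Lo ∧ ¬Hi`, `Lo → ¬Hi → P ∨ M` and `¬(P ∧ M)`, then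
`𝟙_P = ½·(𝟙_{Lo} − 𝟙_{Hi}) + ½·(𝟙_P − 𝟙_M)` in `ℂ`. [cite: Rogawski1990, §4.9 Prop. 4.9.1 (a) p. 55] -/
theorem indicator_eq_half_sub_add_half_of_split {P M Lo Hi : Prop} {_dP : Decidable P} {_dM : Decidable M} {_dLo : Decidable Lo} {_dHi : Decidable Hi}
    (hHiLo : Hi → Lo) (hP : P → Lo ∧ ¬ Hi) (hM : M → Lo ∧ ¬ Hi)
    (hsplit : Lo → ¬ Hi → P ∨ M) (hdisj : ¬ (P ∧ M)) :
    (if P then (1 : ℂ) else 0) =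
      (1 / 2 : ℂ) * ((if Lo then (1 : ℂ) else 0) - (if Hi then (1 : ℂ) else 0)) + (1 / 2 : ℂ) * ((if P then (1 : ℂ) else 0) - (if M then (1 : ℂ) else 0)) := by
  -- the additive form `𝟙_P + 𝟙_M = 𝟙_{Lo} − 𝟙_{Hi}`
  have key : (if P then (1 : ℂ) else 0) + (if M then (1 : ℂ) else 0) = (if Lo then (1 : ℂ) else 0) - (if Hi then (1 : ℂ) else 0) := by
    by_cases hlo : Lo
    · by_cases hhi : Hi
      · have hp : ¬ P := fun hp => (hP hp).2 hhi
        have hm : ¬ M := fun hm => (hM hm).2 hhi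
        rw [if_neg hp, if_neg hm, if_pos hlo, if_pos hhi]; norm_num
      · rcases hsplit hlo hhi with hp | hm
        · have hm : ¬ M := fun hm => hdisj ⟨hp, hm⟩
          rw [if_pos hp, if_neg hm, if_pos hlo, if_neg hhi]; norm_num
        · have hp : ¬ P := fun hp => hdisj ⟨hp, hm⟩
          rw [if_neg hp, if_pos hm, if_pos hlo, if_neg hhi]; norm_num
    · have hhi : ¬ Hi := fun h => hlo (hHiLo h)
      have hp : ¬ P := fun hp => hlo (hP hp).1
      have hm : ¬ M := fun hm => hlo (hM hm).1
      rw [if_neg hp, if_neg hm, if_neg hlo, if_neg hhi]; norm_num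
  linear_combination (1 / 2 : ℂ) * key

/-! ## §1  The abstract socket: rows(f_{T+}) from rows of any three smooth pieces realising the indicator identity -/

/-- **ROWS OF `f_{T+}` FROM AN INDICATOR IDENTITY** (abstract form of the derived road): smooth pieces `glo ghi fsgn` with `pieceTransvPlus = ½·(glo − ghi) + ½·fsgn` at every wild
ramified non-split place, each carrying its three population rows, give `PieceRowsWild gselStar 1` — ★ `pieceRowsWild_sub` ∘ ★ `pieceRowsWild_add_smul` ∘ ★ `pieceRowsWild_congr`
(the `H`-families concatenate, coefficients scale by `½`). [cite: Rogawski1990, §4.3 (4.3.1) p. 43; §4.9 Prop. 4.9.1 (a) pp. 54–55] [cite: LanglandsShelstad1987, §1.3] -/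
theorem pieceRowsWild_transvPlus_of_indicator_identity (glo ghi fsgn : (∀ (L : Type) [Field L] [NumberField L] [IsCMField L] (v : HeightOneSpectrum (𝓞 ↥(maximalRealSubfield L))) (w : UnitaryGroup.PlacesOver L v), IsCMField.complexConj L • w.1 = w.1 → w.1.adicCompletion L → ((UnitaryGroup.cmDatum L 3 (Matrix.of fun i j : Fin 3 => if i.val + j.val + 1 = 3 then (1 : L) else 0)).Local v) → ℂ))
    (hs_lo : ∀ (L : Type) [Field L] [NumberField L] [IsCMField L] {v : HeightOneSpectrum (𝓞 ↥(maximalRealSubfield L))} (w : UnitaryGroup.PlacesOver L v)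
      (hw : IsCMField.complexConj L • w.1 = w.1) (_he : v.asIdeal.ramificationIdx' w.1.asIdeal ≠ 1) (_h2 : ¬ IsUnit (2 : 𝒪[w.1.adicCompletion L]))
      (ϖ : (w.1.adicCompletion L)) (_hϖ : Valued.v ϖ = WithZero.exp (-1 : ℤ)), IsLocSmooth (glo L v w hw ϖ))
    (hs_hi : ∀ (L : Type) [Field L] [NumberField L] [IsCMField L] {v : HeightOneSpectrum (𝓞 ↥(maximalRealSubfield L))} (w : UnitaryGroup.PlacesOver L v)
      (hw : IsCMField.complexConj L • w.1 = w.1) (_he : v.asIdeal.ramificationIdx' w.1.asIdeal ≠ 1) (_h2 : ¬ IsUnit (2 : 𝒪[w.1.adicCompletion L]))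
      (ϖ : (w.1.adicCompletion L)) (_hϖ : Valued.v ϖ = WithZero.exp (-1 : ℤ)), IsLocSmooth (ghi L v w hw ϖ))
    (hs_sgn : ∀ (L : Type) [Field L] [NumberField L] [IsCMField L] {v : HeightOneSpectrum (𝓞 ↥(maximalRealSubfield L))} (w : UnitaryGroup.PlacesOver L v)
      (hw : IsCMField.complexConj L • w.1 = w.1) (_he : v.asIdeal.ramificationIdx' w.1.asIdeal ≠ 1) (_h2 : ¬ IsUnit (2 : 𝒪[w.1.adicCompletion L]))
      (ϖ : (w.1.adicCompletion L)) (_hϖ : Valued.v ϖ = WithZero.exp (-1 : ℤ)), IsLocSmooth (fsgn L v w hw ϖ))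
    (hα : ∀ (L : Type) [Field L] [NumberField L] [IsCMField L] {v : HeightOneSpectrum (𝓞 ↥(maximalRealSubfield L))} (w : UnitaryGroup.PlacesOver L v)
      (hw : IsCMField.complexConj L • w.1 = w.1) (_he : v.asIdeal.ramificationIdx' w.1.asIdeal ≠ 1) (_h2 : ¬ IsUnit (2 : 𝒪[w.1.adicCompletion L]))
      (ϖ : (w.1.adicCompletion L)) (_hϖ : Valued.v ϖ = WithZero.exp (-1 : ℤ)),
      pieceTransvPlus L v w hw ϖ = (1 / 2 : ℂ) • (glo L v w hw ϖ - ghi L v w hw ϖ) + (1 / 2 : ℂ) • fsgn L v w hw ϖ)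
    (hlo : PieceRowsWild (fun _ : Fin 1 => glo) 0) (hhi : PieceRowsWild (fun _ : Fin 1 => ghi) 0) (hsgn : PieceRowsWild (fun _ : Fin 1 => fsgn) 0) :
    PieceRowsWild gselStar 1 :=
  pieceRowsWild_congr _ _ (fun L _ _ _ _ w hw he h2 ϖ hϖ => hα L w hw he h2 ϖ hϖ)
    (pieceRowsWild_add_smul _ _ (fun L _ _ _ _ w hw he h2 ϖ hϖ => (hs_lo L w hw he h2 ϖ hϖ).sub (hs_hi L w hw he h2 ϖ hϖ)) hs_sgn (1 / 2 : ℂ) (1 / 2 : ℂ)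
      (pieceRowsWild_sub glo ghi hs_lo hs_hi hlo hhi) hsgn)

/-! ## §2  The socket of record: clean-level pieces of ★ p858704, the clean sign piece `f_{T+} − T−′`, and (α) as a hypothesis -/

/-- **`T−′ = 𝟙{u ∈ K ∣ shell(ℓ₀, m_c) ∧ ¬LabelPlus(m*)}` IS `IsLocSmooth`** (a level class function: ★ `isLocSmooth_indicator_profile` at level `m_c + m* + 2` with ★ `nearTransvShell_add_iff`,
★ `labelPlus_add_iff`). [cite: BernsteinZelevinsky1976, §1.1] [cite: Kottwitz1986BaseChangeUnits, §1 pp. 240–241] -/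
theorem isLocSmooth_indicator_cleanMinus (mc : (∀ (L : Type) [Field L] [NumberField L] [IsCMField L] (v : HeightOneSpectrum (𝓞 ↥(maximalRealSubfield L))), UnitaryGroup.PlacesOver L v → ℕ)) (L : Type) [Field L] [NumberField L] [IsCMField L]
    {v : HeightOneSpectrum (𝓞 ↥(maximalRealSubfield L))} (w : UnitaryGroup.PlacesOver L v) (hw : IsCMField.complexConj L • w.1 = w.1)
    {ϖ : w.1.adicCompletion L} (hϖ : Valued.v ϖ = WithZero.exp (-1 : ℤ)) :
    IsLocSmooth
      (Set.indicator {u : ((UnitaryGroup.cmDatum L 3 (Matrix.of fun i j : Fin 3 => if i.val + j.val + 1 = 3 then (1 : L) else 0)).Local v) |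
            u ∈ cmLocalIntegralLevel L 3 (Matrix.of fun i j : Fin 3 => if i.val + j.val + 1 = 3 then (1 : L) else 0) v ∧
            (NearTransvShell ϖ (dOfPlace L v w % 2) (mc L v w) (wMatrix L w hw u - 1) ∧
              ¬ LabelPlus (galAdicCompletionMap (L := L) (IsCMField.complexConj L) hw) ϖ (dOfPlace L v w) (mstarFn L v w) (wMatrix L w hw u - 1))} (fun _ => (1 : ℂ))) := by
  obtain ⟨hϖ0, hϖ1, hϖ1'⟩ := uniformizer_facts L w hϖ
  have hvσ : ∀ a : w.1.adicCompletion L, Valued.v ((galAdicCompletionMap (L := L) (IsCMField.complexConj L) hw) a) = Valued.v a := fun a => valued_galAdicCompletionMap (L := L) (IsCMField.complexConj L) hw a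
  have hℓ : dOfPlace L v w % 2 + 1 ≤ mc L v w + mstarFn L v w + 2 := by have := Nat.mod_lt (dOfPlace L v w) (show 0 < 2 by norm_num); omega
  simp only [wMatrix]
  exact (isLocSmooth_indicator_profile L w hw
    (fun X => NearTransvShell ϖ (dOfPlace L v w % 2) (mc L v w) X ∧ ¬ LabelPlus (galAdicCompletionMap (L := L) (IsCMField.complexConj L) hw) ϖ (dOfPlace L v w) (mstarFn L v w) X)
    hϖ0 hϖ1 (show 1 ≤ mc L v w + mstarFn L v w + 2 by omega)
    (fun X D hX hD => and_congr (nearTransvShell_add_iff hϖ0 hϖ1' hℓ (by omega) hX hD) (not_congr (labelPlus_add_iff hvσ hϖ (by omega) _ X hD)))).1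

/-- **THE T₊ SOCKET OF THE DERIVED ROAD** (dealer WORD #50 «(J-T+-derived)»).  GIVEN a clean square-level schedule `mc` with `mstarFn ≤ mc` placewise; (α) «LabelPlus is clean»:
at every wild place, for `u ∈ K` with `X = ι_w u − 1` on the near-transvection shell `(ℓ₀, m*)`, `LabelPlus X → X² ∈ ϖ^{m_c} M₃`; and the three population rows of the clean-level
pieces `𝟙_{K_{ℓ₀,m_c}}`, `𝟙_{K_{ℓ₀+1,m_c}}` (★ p858704's pieces; their rows = ★ p858924's conclusions) and of the clean sign piece `f_sgn′ = f_{T+} − 𝟙{K ∧ shell(ℓ₀,m_c) ∧ ¬LabelPlus(m*)}` —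
THEN `PieceRowsWild gselStar 1` (= `type_of% stub_rows_transvPlus`).  Proof: §0 pointwise at every `u` (`Hi → Lo`, both labelled classes sit in the clean shell `lev ∖ lev′` — for
`f_{T+}` by (α) —, the clean shell splits by the label, the classes are disjoint), then §1. [cite: Rogawski1990, §4.9 Prop. 4.9.1 (a) pp. 54–55; §4.3 (4.3.1) p. 43]
[cite: Kottwitz1986BaseChangeUnits, §1 pp. 240–241] -/
theorem pieceRowsWild_transvPlus_of_levels_of_sgn (mc : (∀ (L : Type) [Field L] [NumberField L] [IsCMField L] (v : HeightOneSpectrum (𝓞 ↥(maximalRealSubfield L))), UnitaryGroup.PlacesOver L v → ℕ))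
    (hmc : ∀ (L : Type) [Field L] [NumberField L] [IsCMField L] (v : HeightOneSpectrum (𝓞 ↥(maximalRealSubfield L))) (w : UnitaryGroup.PlacesOver L v), mstarFn L v w ≤ mc L v w)
    (hα : ∀ (L : Type) [Field L] [NumberField L] [IsCMField L] {v : HeightOneSpectrum (𝓞 ↥(maximalRealSubfield L))} (w : UnitaryGroup.PlacesOver L v)
      (hw : IsCMField.complexConj L • w.1 = w.1) (_he : v.asIdeal.ramificationIdx' w.1.asIdeal ≠ 1) (_h2 : ¬ IsUnit (2 : 𝒪[w.1.adicCompletion L]))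
      (ϖ : (w.1.adicCompletion L)) (_hϖ : Valued.v ϖ = WithZero.exp (-1 : ℤ)),
      ∀ u : ((UnitaryGroup.cmDatum L 3 (Matrix.of fun i j : Fin 3 => if i.val + j.val + 1 = 3 then (1 : L) else 0)).Local v), u ∈ cmLocalIntegralLevel L 3 (Matrix.of fun i j : Fin 3 => if i.val + j.val + 1 = 3 then (1 : L) else 0) v →
        NearTransvShell ϖ (dOfPlace L v w % 2) (mstarFn L v w) (wMatrix L w hw u - 1) →
        LabelPlus (galAdicCompletionMap (L := L) (IsCMField.complexConj L) hw) ϖ (dOfPlace L v w) (mstarFn L v w) (wMatrix L w hw u - 1) →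
        InLevel ϖ (mc L v w) ((wMatrix L w hw u - 1) * (wMatrix L w hw u - 1)))
    (hlo : PieceRowsWild (fun _ : Fin 1 => (fun (L : Type) [Field L] [NumberField L] [IsCMField L] (v : HeightOneSpectrum (𝓞 ↥(maximalRealSubfield L))) (w : UnitaryGroup.PlacesOver L v)
          (hw : IsCMField.complexConj L • w.1 = w.1) (ϖ : w.1.adicCompletion L) =>
        Set.indicator {u : ((UnitaryGroup.cmDatum L 3 (Matrix.of fun i j : Fin 3 => if i.val + j.val + 1 = 3 then (1 : L) else 0)).Local v) |
            u ∈ cmLocalIntegralLevel L 3 (Matrix.of fun i j : Fin 3 => if i.val + j.val + 1 = 3 then (1 : L) else 0) v ∧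
            (InLevel ϖ (dOfPlace L v w % 2) (wMatrix L w hw u - 1) ∧ InLevel ϖ (mc L v w) ((wMatrix L w hw u - 1) * (wMatrix L w hw u - 1)))} (fun _ => (1 : ℂ)))) 0)
    (hhi : PieceRowsWild (fun _ : Fin 1 => (fun (L : Type) [Field L] [NumberField L] [IsCMField L] (v : HeightOneSpectrum (𝓞 ↥(maximalRealSubfield L))) (w : UnitaryGroup.PlacesOver L v)
          (hw : IsCMField.complexConj L • w.1 = w.1) (ϖ : w.1.adicCompletion L) =>
        Set.indicator {u : ((UnitaryGroup.cmDatum L 3 (Matrix.of fun i j : Fin 3 => if i.val + j.val + 1 = 3 then (1 : L) else 0)).Local v) |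
            u ∈ cmLocalIntegralLevel L 3 (Matrix.of fun i j : Fin 3 => if i.val + j.val + 1 = 3 then (1 : L) else 0) v ∧
            (InLevel ϖ (dOfPlace L v w % 2 + 1) (wMatrix L w hw u - 1) ∧ InLevel ϖ (mc L v w) ((wMatrix L w hw u - 1) * (wMatrix L w hw u - 1)))} (fun _ => (1 : ℂ)))) 0)
    (hsgn : PieceRowsWild (fun _ : Fin 1 => (fun (L : Type) [Field L] [NumberField L] [IsCMField L] (v : HeightOneSpectrum (𝓞 ↥(maximalRealSubfield L))) (w : UnitaryGroup.PlacesOver L v)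
          (hw : IsCMField.complexConj L • w.1 = w.1) (ϖ : w.1.adicCompletion L) =>
        pieceTransvPlus L v w hw ϖ -
          (Set.indicator {u : ((UnitaryGroup.cmDatum L 3 (Matrix.of fun i j : Fin 3 => if i.val + j.val + 1 = 3 then (1 : L) else 0)).Local v) |
            u ∈ cmLocalIntegralLevel L 3 (Matrix.of fun i j : Fin 3 => if i.val + j.val + 1 = 3 then (1 : L) else 0) v ∧
            (NearTransvShell ϖ (dOfPlace L v w % 2) (mc L v w) (wMatrix L w hw u - 1) ∧
              ¬ LabelPlus (galAdicCompletionMap (L := L) (IsCMField.complexConj L) hw) ϖ (dOfPlace L v w) (mstarFn L v w) (wMatrix L w hw u - 1))} (fun _ => (1 : ℂ))))) 0) :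
    PieceRowsWild gselStar 1 := by
  refine pieceRowsWild_transvPlus_of_indicator_identity _ _ _
    (fun L _ _ _ v w hw _ _ ϖ hϖ => (isLocSmooth_indicator_levels L w hw hϖ (dOfPlace L v w % 2) (mc L v w)).1)
    (fun L _ _ _ v w hw _ _ ϖ hϖ => (isLocSmooth_indicator_levels L w hw hϖ (dOfPlace L v w % 2 + 1) (mc L v w)).1)
    (fun L _ _ _ _ w hw _ _ ϖ hϖ => (isLocSmooth_pieceTransvPlus L w hw hϖ).1.sub (isLocSmooth_indicator_cleanMinus mc L w hw hϖ))
    (fun L _ _ _ v w hw he h2 ϖ hϖ => ?_) hlo hhi hsgn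
  -- the pointwise identity at this place
  obtain ⟨hϖ0, -, hϖ1'⟩ := uniformizer_facts L w hϖ
  funext u
  simp only [pieceTransvPlus, Pi.add_apply, Pi.smul_apply, Pi.sub_apply, smul_eq_mul, Set.indicator_apply, Set.mem_setOf_eq]
  refine indicator_eq_half_sub_add_half_of_split ?_ ?_ ?_ ?_ ?_
  · -- `Hi → Lo`: `X ∈ ϖ^{ℓ₀+1} M₃ ⇒ X ∈ ϖ^{ℓ₀} M₃`
    rintro ⟨hK, hℓ1, hsq⟩
    exact ⟨hK, inLevel_of_le hϖ0 hϖ1' (Nat.le_succ _) hℓ1, hsq⟩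
  · -- `f_{T+} ⊆ Lo ∖ Hi`, by (α)
    rintro ⟨hK, ⟨hℓ, hnℓ1, hm⟩, hL⟩
    exact ⟨⟨hK, hℓ, hα L w hw he h2 ϖ hϖ u hK ⟨hℓ, hnℓ1, hm⟩ hL⟩, fun h => hnℓ1 h.2.1⟩
  · -- `T−′ ⊆ Lo ∖ Hi`
    rintro ⟨hK, ⟨hℓ, hnℓ1, hmc'⟩, _hnL⟩
    exact ⟨⟨hK, hℓ, hmc'⟩, fun h => hnℓ1 h.2.1⟩
  · -- the clean shell `Lo ∖ Hi` splits by the label (`m* ≤ m_c` puts `f_{T+}`'s square level under the clean one)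
    rintro ⟨hK, hℓ, hmc'⟩ hnHi
    have hnℓ1 : ¬ InLevel ϖ (dOfPlace L v w % 2 + 1) (wMatrix L w hw u - 1) := fun h => hnHi ⟨hK, h, hmc'⟩
    by_cases hL : LabelPlus (galAdicCompletionMap (L := L) (IsCMField.complexConj L) hw) ϖ (dOfPlace L v w) (mstarFn L v w) (wMatrix L w hw u - 1)
    · exact Or.inl ⟨hK, ⟨hℓ, hnℓ1, inLevel_of_le hϖ0 hϖ1' (hmc L v w) hmc'⟩, hL⟩
    · exact Or.inr ⟨hK, ⟨hℓ, hnℓ1, hmc'⟩, hL⟩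
  · -- the two labelled classes are disjoint
    rintro ⟨⟨_, _, hL⟩, ⟨_, _, hnL⟩⟩
    exact hnL hL

end Summit.HodgeConjecture.HodgeConjecture.Cruxes.H413.F0P3cDyRamTransvPlusRowsOfLevelsOfSgn

end
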